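import Literature.MathematicalPhysics.KineticTheory.ReyBelletThomas2002EnergyIdentity
import Literature.MathematicalPhysics.KineticTheory.LangevinChainExpMartingale
import HarnessLib

/-!
# Rey-Bellet–Thomas 2002: the exponential supermartingale bound for the reservoir-driven chain

Trunk T-KINETIC (Literature/MathematicalPhysics/KineticTheory). Second step towards Theorem 3.10 of
Rey-Bellet–Thomas for the named fact `ReyBelletThomas2002_thm21` (provefact unit): the Hölder /
exponential-martingale estimate of its proof (eqs. (40)–(41): "in the next to last line, we have
used the fact that the second factor is the expectation of a martingale (the integrand is
non-anticipating) with expectation 1"), for the transition semigroup constructed in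
`ReyBelletThomas2002Kernel.lean` (pathwise flow driven by the Brownian pair through the reservoir
variables `r`), WITHOUT a general theory of stochastic integration — the twin of
`LangevinChainExpMartingale.lean` (noise on the momenta) with the martingale
`M_t = ∫₀ᵗ √(2γT) r dω` realised as the pathwise functional `rbNoiseWork - γ Tr(T) t` of
`ReyBelletThomas2002EnergyIdentity.lean`:

* `rbEta` — the reservoir noise `(√(2γT_L) B¹, √(2γT_R) B²)` read off a pair of raw paths;
  `rbSolMap_eq_rbFlow`; `rbDiscreteMart`, `rbDiscreteQV`, `rbEnergyMart`, `rbEnergyQV` — the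
  Riemann–Itô sums over uniform grids and their limits `M_t`, `[M]_t = 2γT_L∫r_L² + 2γT_R∫r_R²`;
* `rb_lintegral_exp_discreteMart_eq_one` — `E exp(α 𝔐 - α² 𝔔/2) = 1` EXACTLY for the grid sums
  (cocycle of the flow, weak Markov property of the pair `lintegral_comp_pairShift_eq`, Gaussian
  exponential moment `lintegral_exp_linear_pair_sub`);
* `rb_ae_tendsto_discreteMart`, `rb_tendsto_discreteQV` — convergence along dyadic grids (summation
  by parts for the `C¹` part of `r`, dyadic quadratic variation of Brownian motion, Riemann sums);
* `rb_lintegral_expMart_le_one` — **`E exp(α M_t - α²[M]_t/2) ≤ 1`** (Fatou);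
* `rb_lintegral_exp_rbEnergy_add_dissipation_le` — the energy form used for (41)–(42): for every
  `θ` and `κ = θ(1 - θ T_max)` (positive for `0 < θ < 1/T_max`),
  **`E_x exp(θ G(z_t) + κ Γ_t) ≤ exp(θ G(x) + θγ(T_L+T_R) t)`** (energy identity,
  `[M]_t ≤ 2 T_max Γ_t`).

## References

* L. Rey-Bellet, L. E. Thomas, Comm. Math. Phys. **225** (2002) 305–329, Thm 3.10, eqs. (40)–(41).
* N. Cuneo, J.-P. Eckmann, M. Hairer, L. Rey-Bellet, EJP **23** (2018) no. 55, Lemma 5.5.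
* D. Revuz, M. Yor, *Continuous Martingales and Brownian Motion* (1999), Ch. IV (3.23), §1.
-/

noncomputable section

open MeasureTheory ProbabilityTheory Filter Topology Set Metric Finset
open scoped NNReal ENNReal Topology

namespace Literature.MathematicalPhysics.KineticTheory.HeatConduction

open Literature.Probability.Process Literature.MathematicalPhysics.KineticTheory OscillatorChain
  Literature.Analysis.ODE

variable {N : ℕ}

/-! ### The reservoir noise of the pair and the discrete Itô sums -/

namespace OscillatorChain

variable (P : OscillatorChain)

/-- The **reservoir noise path** read off a pair of raw paths, with the amplitudes
`c_L = √(2γT_L)`, `c_R = √(2γT_R)`: `η(t) = (c_L (w̄₁(t⁺) - w̄₁(0)), c_R (w̄₂(t⁺) - w̄₂(0)))`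
(so that `pairNoise v_L v_R w t = (0, η t)` and `rbSolMap t x w = rbFlow x η t`).
[cite: ReyBelletThomas2002, §2 eq. (12)] -/
def rbEta (N : ℕ) (T_L T_R : ℝ) (w : WienerPair) (t : ℝ) : ℝ × ℝ :=
  ((KineticTheory.pairNoise (P.rbNoiseVec N T_L T_R 0) (P.rbNoiseVec N T_L T_R 1) w t).2.1,
    (KineticTheory.pairNoise (P.rbNoiseVec N T_L T_R 0) (P.rbNoiseVec N T_L T_R 1) w t).2.2)

/-- The **variance rates** `σ_L² = 2γT_L`, `σ_R² = 2γT_R` of the two noise components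
(`d[η_b]_t = σ_b² dt`). [cite: ReyBelletThomas2002, Thm 3.10 eq. (40)] -/
def rbNoiseVar (T_L T_R : ℝ) : ℝ × ℝ := (2 * P.γ * T_L, 2 * P.γ * T_R)

/-- The **Riemann–Itô sum** `𝔐(h, n) = ∑_{k<n} ∑_b r_b(kh) (η_b((k+1)h) - η_b(kh))` of
`∫ r·dη` over the uniform grid of step `h`. [cite: ReyBelletThomas2002, Thm 3.10 eq. (40)] -/
def rbDiscreteMart (Λ : ℝ) (N : ℕ) (T_L T_R : ℝ) (h : ℝ) (n : ℕ) (x : RBPhaseSpace N)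
    (w : WienerPair) : ℝ :=
  ∑ k ∈ range n,
    ((P.rbSolMap Λ N T_L T_R (k * h) x w).2.1 *
        ((P.rbEta N T_L T_R w ((k + 1) * h)).1 - (P.rbEta N T_L T_R w (k * h)).1) +
      (P.rbSolMap Λ N T_L T_R (k * h) x w).2.2 *
        ((P.rbEta N T_L T_R w ((k + 1) * h)).2 - (P.rbEta N T_L T_R w (k * h)).2))

/-- The **discrete quadratic variation** `𝔔(h, n) = ∑_{k<n} (σ_L² r_L(kh)² + σ_R² r_R(kh)²) h`.
[cite: ReyBelletThomas2002, Thm 3.10 eq. (40)] -/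
def rbDiscreteQV (Λ : ℝ) (N : ℕ) (T_L T_R : ℝ) (h : ℝ) (n : ℕ) (x : RBPhaseSpace N)
    (w : WienerPair) : ℝ :=
  ∑ k ∈ range n,
    ((P.rbNoiseVar T_L T_R).1 * (P.rbSolMap Λ N T_L T_R (k * h) x w).2.1 ^ 2 +
      (P.rbNoiseVar T_L T_R).2 * (P.rbSolMap Λ N T_L T_R (k * h) x w).2.2 ^ 2) * h

/-- The **martingale part of the energy** `M_t = 𝓜_t - (σ_L² + σ_R²) t / 2` (the work of the noise
minus its compensator `γ Tr(T) t`), a pathwise functional. [cite: ReyBelletThomas2002, Thm 3.10 eq. (40)] -/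
def rbEnergyMart (Λ : ℝ) (N : ℕ) (T_L T_R : ℝ) (t : ℝ) (x : RBPhaseSpace N) (w : WienerPair) : ℝ :=
  P.rbNoiseWork Λ N x (P.rbEta N T_L T_R w) t -
    ((P.rbNoiseVar T_L T_R).1 + (P.rbNoiseVar T_L T_R).2) * t / 2

/-- Its **quadratic variation** `[M]_t = σ_L² ∫₀ᵗ r_L² + σ_R² ∫₀ᵗ r_R²`.
[cite: ReyBelletThomas2002, Thm 3.10 eq. (41)] -/
def rbEnergyQV (Λ : ℝ) (N : ℕ) (T_L T_R : ℝ) (t : ℝ) (x : RBPhaseSpace N) (w : WienerPair) : ℝ :=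
  (P.rbNoiseVar T_L T_R).1 * (∫ s in (0 : ℝ)..t, (P.rbSolMap Λ N T_L T_R s x w).2.1 ^ 2) +
    (P.rbNoiseVar T_L T_R).2 * ∫ s in (0 : ℝ)..t, (P.rbSolMap Λ N T_L T_R s x w).2.2 ^ 2

/-- The noise of the pair along the reservoir noise vectors is `(0, η)`. [folklore] -/
theorem pairNoise_rbNoiseVec_eq (N : ℕ) (T_L T_R : ℝ) (w : WienerPair) (t : ℝ) :
    KineticTheory.pairNoise (P.rbNoiseVec N T_L T_R 0) (P.rbNoiseVec N T_L T_R 1) w t =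
      (((0 : PhaseSpace N), P.rbEta N T_L T_R w t) : RBPhaseSpace N) := by
  have h1 : (KineticTheory.pairNoise (P.rbNoiseVec N T_L T_R 0) (P.rbNoiseVec N T_L T_R 1) w t).1 = 0 := by
    simp [KineticTheory.pairNoise, rbNoiseVec, rbUnitRL_eq, rbUnitRR_eq]
  refine Prod.ext h1 (Prod.ext rfl rfl)

/-- `rbSolMap` is the flow driven by `rbEta`. [folklore] -/
theorem rbSolMap_eq_rbFlow (Λ : ℝ) (N : ℕ) (T_L T_R : ℝ) (t : ℝ) (x : RBPhaseSpace N)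
    (w : WienerPair) : P.rbSolMap Λ N T_L T_R t x w = P.rbFlow Λ N x (P.rbEta N T_L T_R w) t := by
  unfold rbSolMap sdeSolMap rbFlow
  congr 1
  funext s
  exact P.pairNoise_rbNoiseVec_eq N T_L T_R w s

/-- The reservoir noise path is continuous in time. [folklore] -/
theorem continuous_rbEta (N : ℕ) (T_L T_R : ℝ) (w : WienerPair) : Continuous (P.rbEta N T_L T_R w) := by
  have h := KineticTheory.continuous_pairNoise (P.rbNoiseVec N T_L T_R 0) (P.rbNoiseVec N T_L T_R 1) w
  unfold rbEta
  exact (continuous_fst.comp (continuous_snd.comp h)).prodMk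
    (continuous_snd.comp (continuous_snd.comp h))

/-- The reservoir noise at a fixed time is measurable in the pair. [folklore] -/
theorem measurable_rbEta (N : ℕ) (T_L T_R : ℝ) (t : ℝ) :
    Measurable fun w => P.rbEta N T_L T_R w t := by
  have h := KineticTheory.measurable_pairNoise (P.rbNoiseVec N T_L T_R 0) (P.rbNoiseVec N T_L T_R 1) t
  unfold rbEta
  exact (measurable_fst.comp (measurable_snd.comp h)).prodMk
    (measurable_snd.comp (measurable_snd.comp h))

/-- `η(0) = 0`. [folklore] -/
@[simp] theorem rbEta_zero (N : ℕ) (T_L T_R : ℝ) (w : WienerPair) : P.rbEta N T_L T_R w 0 = 0 := by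
  simp [rbEta, KineticTheory.pairNoise_zero]

/-- The noise of the Brownian pair: `η(t) = (c_L B¹_{t⁺}, c_R B²_{t⁺})`. [folklore] -/
theorem rbEta_pairPath (N : ℕ) (T_L T_R : ℝ) (ω : WienerPair) (t : ℝ) :
    P.rbEta N T_L T_R (pairPath ω) t =
      (Real.sqrt (2 * P.γ * T_L) * brownian t.toNNReal ω.1,
        Real.sqrt (2 * P.γ * T_R) * brownian t.toNNReal ω.2) := by
  unfold rbEta
  rw [KineticTheory.pairNoise_pairPath]
  simp [rbNoiseVec, rbUnitRL_eq, rbUnitRR_eq]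
  constructor <;> ring

/-- The noise of the shifted pair is the shifted noise (on `t ≥ 0`). [folklore] -/
theorem rbEta_pairShift (N : ℕ) (T_L T_R : ℝ) (s : ℝ≥0) (ω : WienerPair) {t : ℝ} (ht : 0 ≤ t) :
    P.rbEta N T_L T_R (pairShift s ω) t =
      P.rbEta N T_L T_R (pairPath ω) (s + t) - P.rbEta N T_L T_R (pairPath ω) s := by
  unfold rbEta
  rw [KineticTheory.pairNoise_pairShift _ _ s ω ht]
  rfl

/-- The variance rates are nonnegative (`γ, T_L, T_R ≥ 0`). [folklore] -/
theorem rbNoiseVar_nonneg (hγ : 0 ≤ P.γ) {T_L T_R : ℝ} (hL : 0 ≤ T_L) (hR : 0 ≤ T_R) :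
    0 ≤ (P.rbNoiseVar T_L T_R).1 ∧ 0 ≤ (P.rbNoiseVar T_L T_R).2 := by
  unfold rbNoiseVar
  exact ⟨by positivity, by positivity⟩

/-- `σ_b² ≤ 2γ T_max` (`γ ≥ 0`). [folklore] -/
theorem rbNoiseVar_le (hγ : 0 ≤ P.γ) (T_L T_R : ℝ) :
    (P.rbNoiseVar T_L T_R).1 ≤ 2 * P.γ * max T_L T_R ∧ (P.rbNoiseVar T_L T_R).2 ≤ 2 * P.γ * max T_L T_R := by
  unfold rbNoiseVar
  exact ⟨mul_le_mul_of_nonneg_left (le_max_left _ _) (by positivity),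
    mul_le_mul_of_nonneg_left (le_max_right _ _) (by positivity)⟩

/-- `σ_L² + σ_R² = 2γ(T_L + T_R)`. [folklore] -/
theorem rbNoiseVar_add (T_L T_R : ℝ) :
    (P.rbNoiseVar T_L T_R).1 + (P.rbNoiseVar T_L T_R).2 = 2 * P.γ * (T_L + T_R) := by
  unfold rbNoiseVar; ring

end OscillatorChain

/-! ### Wrappers of the generic flow API for `rbSolMap` -/

section Wrap

variable {P : OscillatorChain} {k₁ k₂ : ℝ} (hU : RBGrowth P.U k₁) (hV : RBGrowth P.V k₂)
  (hk₁ : 1 ≤ k₁) (hk₂ : 1 ≤ k₂) (hγ : 0 ≤ P.γ) (Λ : ℝ) (N : ℕ) (T_L T_R : ℝ)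
include hU hV hk₁ hk₂ hγ

/-- `Φ_t(x, w) = x` for `t ≤ 0`. [folklore] -/
theorem rbSolMap_of_nonpos (x : RBPhaseSpace N) (w : WienerPair) {t : ℝ} (ht : t ≤ 0) :
    P.rbSolMap Λ N T_L T_R t x w = x :=
  (P.rbConfinedDrift hU hV hk₁ hk₂ hγ Λ N).sdeSolMap_of_nonpos (v₁ := P.rbNoiseVec N T_L T_R 0)
    (v₂ := P.rbNoiseVec N T_L T_R 1) x w ht

/-- **The cocycle property through the Brownian pair**: `Φ_{s+t}(x, B(ω)) = Φ_t(Φ_s(x, B(ω)), B(θ_s ω))`.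
[folklore] -/
theorem rbSolMap_add_pairPath (s : ℝ≥0) {t : ℝ} (ht : 0 ≤ t) (x : RBPhaseSpace N) (ω : WienerPair) :
    P.rbSolMap Λ N T_L T_R (s + t) x (pairPath ω) =
      P.rbSolMap Λ N T_L T_R t (P.rbSolMap Λ N T_L T_R s x (pairPath ω)) (pairShift s ω) :=
  (P.rbConfinedDrift hU hV hk₁ hk₂ hγ Λ N).sdeSolMap_add_pairPath (P.rbNoiseVec_mem N T_L T_R 0)
    (P.rbNoiseVec_mem N T_L T_R 1) s ht x ω

/-- The solution map is jointly measurable in `(x, w)`. [folklore] -/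
theorem measurable_rbSolMap (t : ℝ) :
    Measurable fun p : RBPhaseSpace N × WienerPair => P.rbSolMap Λ N T_L T_R t p.1 p.2 :=
  (P.rbConfinedDrift hU hV hk₁ hk₂ hγ Λ N).measurable_sdeSolMap (P.rbNoiseVec_mem N T_L T_R 0)
    (P.rbNoiseVec_mem N T_L T_R 1) t

/-- The state at time `s` is measurable with respect to the past of the pair up to time `s`.
[folklore] -/
theorem measurable_comap_pairPast_rbSolMap (s : ℝ≥0) (x : RBPhaseSpace N) :
    Measurable[MeasurableSpace.comap (pairPast s) inferInstance]
      fun ω : WienerPair => P.rbSolMap Λ N T_L T_R s x (pairPath ω) :=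
  (P.rbConfinedDrift hU hV hk₁ hk₂ hγ Λ N).measurable_comap_pairPast_sdeSolMap
    (P.rbNoiseVec_mem N T_L T_R 0) (P.rbNoiseVec_mem N T_L T_R 1) s x

end Wrap

/-! ### The exact exponential identity for the discrete Itô sums -/

section Discrete

variable {P : OscillatorChain} {k₁ k₂ : ℝ} (hU : RBGrowth P.U k₁) (hV : RBGrowth P.V k₂)
  (hk₁ : 1 ≤ k₁) (hk₂ : 1 ≤ k₂) (hγ : 0 ≤ P.γ) (Λ : ℝ) (N : ℕ) {T_L T_R : ℝ}
  (hTL : 0 ≤ T_L) (hTR : 0 ≤ T_R)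
include hU hV hk₁ hk₂ hγ

/-- One step of the grid: `𝔐(h, n+1, x, B(ω)) = ∑_b x_{r,b} η_b(h)(ω) + 𝔐(h, n, Φ_h(x, B(ω)), θ_h ω)`
(the cocycle property of the flow and `η(θ_h ω)(t) = η(ω)(h + t) - η(ω)(h)`). [folklore] -/
theorem rb_discreteMart_succ {h : ℝ} (hh : 0 ≤ h) (n : ℕ) (x : RBPhaseSpace N) (ω : WienerPair) :
    P.rbDiscreteMart Λ N T_L T_R h (n + 1) x (pairPath ω) =
      (x.2.1 * (P.rbEta N T_L T_R (pairPath ω) h).1 + x.2.2 * (P.rbEta N T_L T_R (pairPath ω) h).2) +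
        P.rbDiscreteMart Λ N T_L T_R h n (P.rbSolMap Λ N T_L T_R h x (pairPath ω))
          (pairShift h.toNNReal ω) := by
  unfold OscillatorChain.rbDiscreteMart
  rw [sum_range_succ']
  simp only [Nat.cast_zero, zero_mul, zero_add, one_mul, Nat.cast_succ]
  rw [add_comm]
  congr 1
  · -- the `k = 0` term: `Φ_0 = id`, `η(0) = 0`
    rw [rbSolMap_of_nonpos hU hV hk₁ hk₂ hγ Λ N T_L T_R x _ le_rfl, P.rbEta_zero]
    simp
  · -- the `k + 1` terms: cocycle and shifted noise
    refine sum_congr rfl fun k _ => ?_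
    have hk : (0 : ℝ) ≤ k * h := by positivity
    have hk1 : (0 : ℝ) ≤ (k + 1) * h := by positivity
    have hc : ((h.toNNReal : ℝ≥0) : ℝ) = h := Real.coe_toNNReal h hh
    have hZ : P.rbSolMap Λ N T_L T_R ((k + 1) * h) x (pairPath ω) =
        P.rbSolMap Λ N T_L T_R (k * h) (P.rbSolMap Λ N T_L T_R h x (pairPath ω))
          (pairShift h.toNNReal ω) := by
      have := rbSolMap_add_pairPath hU hV hk₁ hk₂ hγ Λ N T_L T_R h.toNNReal hk x ω
      rw [hc] at this
      rw [← this]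
      congr 1
      ring
    have hη : ∀ {u : ℝ}, 0 ≤ u → P.rbEta N T_L T_R (pairShift h.toNNReal ω) u =
        P.rbEta N T_L T_R (pairPath ω) (h + u) - P.rbEta N T_L T_R (pairPath ω) h := by
      intro u hu
      have := P.rbEta_pairShift N T_L T_R h.toNNReal ω hu
      rwa [hc] at this
    have e2 : ((k : ℝ) + 1 + 1) * h = h + (k + 1) * h := by ring
    have e1 : ((k : ℝ) + 1) * h = h + k * h := by ring
    rw [hZ, hη hk1, hη hk, e2]
    simp only [Prod.fst_sub, Prod.snd_sub]
    rw [e1]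
    ring

/-- One step of the grid for the discrete quadratic variation. [folklore] -/
theorem rb_discreteQV_succ {h : ℝ} (hh : 0 ≤ h) (n : ℕ) (x : RBPhaseSpace N) (ω : WienerPair) :
    P.rbDiscreteQV Λ N T_L T_R h (n + 1) x (pairPath ω) =
      ((P.rbNoiseVar T_L T_R).1 * x.2.1 ^ 2 + (P.rbNoiseVar T_L T_R).2 * x.2.2 ^ 2) * h +
        P.rbDiscreteQV Λ N T_L T_R h n (P.rbSolMap Λ N T_L T_R h x (pairPath ω))
          (pairShift h.toNNReal ω) := by
  unfold OscillatorChain.rbDiscreteQV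
  rw [sum_range_succ']
  simp only [Nat.cast_zero, zero_mul, Nat.cast_succ]
  rw [add_comm]
  congr 1
  · rw [rbSolMap_of_nonpos hU hV hk₁ hk₂ hγ Λ N T_L T_R x _ le_rfl]
  · refine sum_congr rfl fun k _ => ?_
    have hk : (0 : ℝ) ≤ k * h := by positivity
    have hc : ((h.toNNReal : ℝ≥0) : ℝ) = h := Real.coe_toNNReal h hh
    have hZ : P.rbSolMap Λ N T_L T_R ((k + 1) * h) x (pairPath ω) =
        P.rbSolMap Λ N T_L T_R (k * h) (P.rbSolMap Λ N T_L T_R h x (pairPath ω))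
          (pairShift h.toNNReal ω) := by
      have := rbSolMap_add_pairPath hU hV hk₁ hk₂ hγ Λ N T_L T_R h.toNNReal hk x ω
      rw [hc] at this
      rw [← this]
      congr 1
      ring
    rw [hZ]

/-- The discrete sums are jointly measurable in `(x, w)`. [folklore] -/
theorem rb_measurable_discreteMart (h : ℝ) (n : ℕ) :
    Measurable fun p : RBPhaseSpace N × WienerPair =>
      P.rbDiscreteMart Λ N T_L T_R h n p.1 p.2 := by
  unfold OscillatorChain.rbDiscreteMart
  refine Finset.measurable_sum _ fun k _ => ?_
  have hS := measurable_rbSolMap hU hV hk₁ hk₂ hγ Λ N T_L T_R (k * h)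
  have h1 : Measurable fun p : RBPhaseSpace N × WienerPair =>
      (P.rbSolMap Λ N T_L T_R (k * h) p.1 p.2).2.1 := measurable_fst.comp (measurable_snd.comp hS)
  have h2 : Measurable fun p : RBPhaseSpace N × WienerPair =>
      (P.rbSolMap Λ N T_L T_R (k * h) p.1 p.2).2.2 := measurable_snd.comp (measurable_snd.comp hS)
  have hη : ∀ t, Measurable fun p : RBPhaseSpace N × WienerPair => P.rbEta N T_L T_R p.2 t :=
    fun t => (P.measurable_rbEta N T_L T_R t).comp measurable_snd
  exact (h1.mul ((measurable_fst.comp (hη _)).sub (measurable_fst.comp (hη _)))).add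
    (h2.mul ((measurable_snd.comp (hη _)).sub (measurable_snd.comp (hη _))))

/-- The discrete quadratic variation is jointly measurable in `(x, w)`. [folklore] -/
theorem rb_measurable_discreteQV (h : ℝ) (n : ℕ) :
    Measurable fun p : RBPhaseSpace N × WienerPair =>
      P.rbDiscreteQV Λ N T_L T_R h n p.1 p.2 := by
  unfold OscillatorChain.rbDiscreteQV
  refine Finset.measurable_sum _ fun k _ => ?_
  have hS := measurable_rbSolMap hU hV hk₁ hk₂ hγ Λ N T_L T_R (k * h)
  have h1 : Measurable fun p : RBPhaseSpace N × WienerPair =>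
      (P.rbSolMap Λ N T_L T_R (k * h) p.1 p.2).2.1 := measurable_fst.comp (measurable_snd.comp hS)
  have h2 : Measurable fun p : RBPhaseSpace N × WienerPair =>
      (P.rbSolMap Λ N T_L T_R (k * h) p.1 p.2).2.2 := measurable_snd.comp (measurable_snd.comp hS)
  exact (((h1.pow_const 2).const_mul _).add ((h2.pow_const 2).const_mul _)).mul_const _

include hTL hTR in
omit hU hV hk₁ hk₂ in
/-- **The Gaussian step**: `E exp(α (x_{r,L} η_L(h) + x_{r,R} η_R(h)) - α²/2 (σ_L² x_{r,L}² + σ_R² x_{r,R}²) h) = 1`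
(`η_b(h) = c_b B^b_h`, `σ_b² = c_b²`; `lintegral_exp_linear_pair_sub`). [folklore] -/
theorem rb_lintegral_exp_linear_noise (α : ℝ) {h : ℝ} (hh : 0 ≤ h) (x : RBPhaseSpace N) :
    ∫⁻ ω, ENNReal.ofReal (Real.exp (α * (x.2.1 * (P.rbEta N T_L T_R (pairPath ω) h).1 +
        x.2.2 * (P.rbEta N T_L T_R (pairPath ω) h).2) -
        α ^ 2 / 2 * (((P.rbNoiseVar T_L T_R).1 * x.2.1 ^ 2 + (P.rbNoiseVar T_L T_R).2 * x.2.2 ^ 2) * h)))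
      ∂wienerPair = 1 := by
  set cL := Real.sqrt (2 * P.γ * T_L) with hcL
  set cR := Real.sqrt (2 * P.γ * T_R) with hcR
  have hcL2 : cL ^ 2 = 2 * P.γ * T_L := Real.sq_sqrt (by positivity)
  have hcR2 : cR ^ 2 = 2 * P.γ * T_R := Real.sq_sqrt (by positivity)
  have hvar : (P.rbNoiseVar T_L T_R).1 = cL ^ 2 ∧ (P.rbNoiseVar T_L T_R).2 = cR ^ 2 := by
    unfold OscillatorChain.rbNoiseVar; exact ⟨hcL2.symm, hcR2.symm⟩
  have := lintegral_exp_linear_pair_sub h.toNNReal (α * (cL * x.2.1)) (α * (cR * x.2.2))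
  rw [Real.coe_toNNReal h hh] at this
  refine (lintegral_congr fun ω => ?_).trans this
  rw [P.rbEta_pairPath, hvar.1, hvar.2]
  congr 2
  simp only [hcL, hcR]
  ring

omit hU hV hk₁ hk₂ hγ in
/-- The noise at time `h` read off the Brownian pair is measurable with respect to the past of the
pair up to time `h`. [folklore] -/
theorem rb_measurable_comap_pairPast_rbEta (h : ℝ) :
    Measurable[MeasurableSpace.comap (pairPast h.toNNReal) inferInstance]
      fun ω : WienerPair => P.rbEta N T_L T_R (pairPath ω) h := by
  set g : (Set.Iic h.toNNReal → ℝ) × (Set.Iic h.toNNReal → ℝ) → ℝ × ℝ := fun q =>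
    (Real.sqrt (2 * P.γ * T_L) * q.1 ⟨h.toNNReal, Set.self_mem_Iic⟩,
      Real.sqrt (2 * P.γ * T_R) * q.2 ⟨h.toNNReal, Set.self_mem_Iic⟩) with hg
  have hgm : Measurable g :=
    (((measurable_pi_apply _).comp measurable_fst).const_mul _).prodMk
      (((measurable_pi_apply _).comp measurable_snd).const_mul _)
  have hfun : (fun ω : WienerPair => P.rbEta N T_L T_R (pairPath ω) h) = g ∘ pairPast h.toNNReal := by
    funext ω
    simp only [hg, Function.comp_apply, P.rbEta_pairPath, pairPast_fst_apply, pairPast_snd_apply]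
  rw [hfun]
  exact hgm.comp (comap_measurable (pairPast h.toNNReal))

include hTL hTR in
/-- **The exact exponential identity for the Riemann–Itô sums** (the discrete Doléans–Dade
martingale has expectation one): for every step `h ≥ 0`, every number of steps `n` and every
start `x`, `E exp(α 𝔐(h,n,x) - α²/2 𝔔(h,n,x)) = 1`. Induction on `n`: split off the first step,
factorise the expectation at time `h` by the weak Markov property of the pair (the state
`Φ_h(x, B)` and `η(h)` are measurable with respect to the past), apply the induction hypothesis
from the new state, and finish with the Gaussian step. [cite: ReyBelletThomas2002, Thm 3.10 eq. (41)] -/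
theorem rb_lintegral_exp_discreteMart_eq_one (α : ℝ) {h : ℝ} (hh : 0 ≤ h) :
    ∀ (n : ℕ) (x : RBPhaseSpace N),
      ∫⁻ ω, ENNReal.ofReal (Real.exp (α * P.rbDiscreteMart Λ N T_L T_R h n x (pairPath ω) -
          α ^ 2 / 2 * P.rbDiscreteQV Λ N T_L T_R h n x (pairPath ω))) ∂wienerPair = 1
  | 0, x => by simp [OscillatorChain.rbDiscreteMart, OscillatorChain.rbDiscreteQV]
  | n + 1, x => by
    have ih := rb_lintegral_exp_discreteMart_eq_one α hh n
    -- the two factors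
    set g : ℝ × ℝ → ℝ≥0∞ := fun e => ENNReal.ofReal (Real.exp (α * (x.2.1 * e.1 + x.2.2 * e.2) -
      α ^ 2 / 2 * (((P.rbNoiseVar T_L T_R).1 * x.2.1 ^ 2 + (P.rbNoiseVar T_L T_R).2 * x.2.2 ^ 2) * h)))
      with hg
    set F : RBPhaseSpace N × WienerPair → ℝ≥0∞ := fun p => ENNReal.ofReal (Real.exp
      (α * P.rbDiscreteMart Λ N T_L T_R h n p.1 p.2 - α ^ 2 / 2 * P.rbDiscreteQV Λ N T_L T_R h n p.1 p.2))
      with hF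
    set G : ((ℝ × ℝ) × RBPhaseSpace N) × WienerPair → ℝ≥0∞ := fun p => g p.1.1 * F (p.1.2, p.2) with hG
    have hgm : Measurable g := by
      refine ENNReal.measurable_ofReal.comp (Real.measurable_exp.comp ?_)
      exact (((measurable_fst.const_mul _).add (measurable_snd.const_mul _)).const_mul _).sub
        measurable_const
    have hFm : Measurable F := ENNReal.measurable_ofReal.comp (Real.measurable_exp.comp
      (((rb_measurable_discreteMart hU hV hk₁ hk₂ hγ Λ N h n).const_mul _).sub
        ((rb_measurable_discreteQV hU hV hk₁ hk₂ hγ Λ N h n).const_mul _)))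
    have hGm : Measurable G :=
      (hgm.comp (measurable_fst.comp measurable_fst)).mul
        (hFm.comp ((measurable_snd.comp measurable_fst).prodMk measurable_snd))
    -- the past-measurable data at time `h`
    set ξ : WienerPair → (ℝ × ℝ) × RBPhaseSpace N := fun ω =>
      (P.rbEta N T_L T_R (pairPath ω) h, P.rbSolMap Λ N T_L T_R h x (pairPath ω)) with hξ
    have hξm : Measurable[MeasurableSpace.comap (pairPast h.toNNReal) inferInstance] ξ := by
      refine Measurable.prodMk (rb_measurable_comap_pairPast_rbEta (P := P) N h) ?_
      have := measurable_comap_pairPast_rbSolMap hU hV hk₁ hk₂ hγ Λ N T_L T_R h.toNNReal x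
      rwa [Real.coe_toNNReal h hh] at this
    -- rewrite the integrand as `G(ξ ω, θ_h ω)`
    have hint : ∀ ω, ENNReal.ofReal (Real.exp (α * P.rbDiscreteMart Λ N T_L T_R h (n + 1) x (pairPath ω) -
        α ^ 2 / 2 * P.rbDiscreteQV Λ N T_L T_R h (n + 1) x (pairPath ω))) =
        G (ξ ω, pairShift h.toNNReal ω) := by
      intro ω
      rw [rb_discreteMart_succ hU hV hk₁ hk₂ hγ Λ N hh, rb_discreteQV_succ hU hV hk₁ hk₂ hγ Λ N hh]
      simp only [hG, hg, hF, hξ]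
      rw [← ENNReal.ofReal_mul (Real.exp_pos _).le, ← Real.exp_add]
      congr 2
      ring
    simp_rw [hint]
    rw [lintegral_comp_pairShift_eq h.toNNReal hξm hGm]
    -- inner integral: the induction hypothesis from the new state
    have hinner : ∀ ω, ∫⁻ ω', G (ξ ω, pairPath ω') ∂wienerPair = g (ξ ω).1 := by
      intro ω
      simp only [hG]
      rw [lintegral_const_mul (g (ξ ω).1) (f := fun ω' => F ((ξ ω).2, pairPath ω'))
        (hFm.comp (measurable_const.prodMk measurable_pairPath))]
      simp only [hF, hξ]
      rw [ih, mul_one]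
    simp_rw [hinner]
    simp only [hξ, hg]
    exact rb_lintegral_exp_linear_noise hγ N hTL hTR α hh x

end Discrete

/-! ### Convergence of the discrete sums along the dyadic grids -/

section Limit

variable {P : OscillatorChain} {k₁ k₂ : ℝ} (hU : RBGrowth P.U k₁) (hV : RBGrowth P.V k₂)
  (hk₁ : 1 ≤ k₁) (hk₂ : 1 ≤ k₂) (hγ : 0 ≤ P.γ) (Λ : ℝ) (N : ℕ) (T_L T_R : ℝ)
include hU hV hk₁ hk₂ hγ

/-- **The discrete quadratic variation converges to `[M]_t` for every path** (left Riemann sums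
of the continuous functions `r_b(s)²`). [folklore] -/
theorem rb_tendsto_discreteQV {t : ℝ} (ht : 0 ≤ t) (x : RBPhaseSpace N) (w : WienerPair) :
    Tendsto (fun n : ℕ => P.rbDiscreteQV Λ N T_L T_R (t / n) n x w) atTop
      (𝓝 (P.rbEnergyQV Λ N T_L T_R t x w)) := by
  have hzc := continuous_rbSolMap hU hV hk₁ hk₂ hγ Λ N T_L T_R x w
  have hc1 : Continuous fun s => (P.rbSolMap Λ N T_L T_R s x w).2.1 ^ 2 :=
    (continuous_fst.comp (continuous_snd.comp hzc)).pow 2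
  have hc2 : Continuous fun s => (P.rbSolMap Λ N T_L T_R s x w).2.2 ^ 2 :=
    (continuous_snd.comp (continuous_snd.comp hzc)).pow 2
  have hswap : ∀ n : ℕ, P.rbDiscreteQV Λ N T_L T_R (t / n) n x w =
      (P.rbNoiseVar T_L T_R).1 * ∑ k ∈ range n, (P.rbSolMap Λ N T_L T_R (k * (t / n)) x w).2.1 ^ 2 * (t / n) +
      (P.rbNoiseVar T_L T_R).2 * ∑ k ∈ range n, (P.rbSolMap Λ N T_L T_R (k * (t / n)) x w).2.2 ^ 2 * (t / n) := by
    intro n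
    unfold OscillatorChain.rbDiscreteQV
    rw [mul_sum, mul_sum, ← sum_add_distrib]
    exact sum_congr rfl fun k _ => by ring
  simp_rw [hswap]
  unfold OscillatorChain.rbEnergyQV
  exact ((tendsto_riemannSum_of_continuous hc1 ht).const_mul _).add
    ((tendsto_riemannSum_of_continuous hc2 ht).const_mul _)

/-- The `C¹` part of the reservoir variables along the flow: for `s ≥ 0`,
`r_b(s) - η_b(s) = x_{r,b} + ∫₀ˢ Y(z(u))_{r_b} du`. [folklore] -/
theorem rb_solMap_sub_eta_eq (x : RBPhaseSpace N) (ω : WienerPair) {s : ℝ} (hs : 0 ≤ s) :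
    (P.rbSolMap Λ N T_L T_R s x (pairPath ω)).2.1 - (P.rbEta N T_L T_R (pairPath ω) s).1 =
        x.2.1 + ∫ u in (0 : ℝ)..s, (P.rbDrift Λ N (P.rbSolMap Λ N T_L T_R u x (pairPath ω))).2.1 ∧
      (P.rbSolMap Λ N T_L T_R s x (pairPath ω)).2.2 - (P.rbEta N T_L T_R (pairPath ω) s).2 =
        x.2.2 + ∫ u in (0 : ℝ)..s, (P.rbDrift Λ N (P.rbSolMap Λ N T_L T_R u x (pairPath ω))).2.2 := by
  set η := P.rbEta N T_L T_R (pairPath ω) with hη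
  have hηc : Continuous η := P.continuous_rbEta N T_L T_R _
  have hflow : ∀ u, P.rbSolMap Λ N T_L T_R u x (pairPath ω) = P.rbFlow Λ N x η u := fun u =>
    P.rbSolMap_eq_rbFlow Λ N T_L T_R u x (pairPath ω)
  have hsol := (isIntegralSolutionOn_rbFlow hU hV hk₁ hk₂ hγ Λ N x hηc s) s ⟨hs, le_rfl⟩
  have hYc : Continuous (P.rbDrift Λ N) := (P.contDiff_rbDrift hU.1 hV.1 Λ N).continuous
  have hzc : Continuous (P.rbFlow Λ N x η) := continuous_rbFlow hU hV hk₁ hk₂ hγ Λ N x hηc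
  have hfi : IntervalIntegrable (fun u => P.rbDrift Λ N (P.rbFlow Λ N x η u)) volume 0 s :=
    (hYc.comp hzc).intervalIntegrable _ _
  have e21 : (∫ u in (0 : ℝ)..s, P.rbDrift Λ N (P.rbFlow Λ N x η u)).2.1 =
      ∫ u in (0 : ℝ)..s, (P.rbDrift Λ N (P.rbFlow Λ N x η u)).2.1 := by
    have h := (((ContinuousLinearMap.fst ℝ ℝ ℝ).comp
      (ContinuousLinearMap.snd ℝ (PhaseSpace N) (ℝ × ℝ))).intervalIntegral_comp_comm hfi)
    simpa using h.symm
  have e22 : (∫ u in (0 : ℝ)..s, P.rbDrift Λ N (P.rbFlow Λ N x η u)).2.2 =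
      ∫ u in (0 : ℝ)..s, (P.rbDrift Λ N (P.rbFlow Λ N x η u)).2.2 := by
    have h := (((ContinuousLinearMap.snd ℝ ℝ ℝ).comp
      (ContinuousLinearMap.snd ℝ (PhaseSpace N) (ℝ × ℝ))).intervalIntegral_comp_comm hfi)
    simpa using h.symm
  simp_rw [hflow]
  have h21 := congrArg (fun v : RBPhaseSpace N => v.2.1) hsol
  have h22 := congrArg (fun v : RBPhaseSpace N => v.2.2) hsol
  simp only [Prod.snd_add, Prod.fst_add] at h21 h22
  rw [e21] at h21
  rw [e22] at h22
  constructor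
  · simp only [hη] at h21 ⊢; linarith
  · simp only [hη] at h22 ⊢; linarith

/-- **The Riemann–Itô sums converge to `M_t` almost surely along the dyadic grids**: for each
reservoir, `r_b = A_b + η_b` with `A_b ∈ C¹`; `∑ A_b(s_k)Δ_kη_b → A_b(t)η_b(t) - ∫₀ᵗ η_b A_b'`
by summation by parts and the convergence of tagged Riemann–Stieltjes sums (every path), and
`∑ η_b(s_k)Δ_kη_b = (η_b(t)² - ∑(Δ_kη_b)²)/2 → (η_b(t)² - σ_b² t)/2` by the almost sure dyadic
quadratic variation of the two Brownian motions. [cite: ReyBelletThomas2002, Thm 3.10 eq. (40)] -/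
theorem rb_ae_tendsto_discreteMart (hTL : 0 ≤ T_L) (hTR : 0 ≤ T_R) {t : ℝ} (ht : 0 ≤ t)
    (x : RBPhaseSpace N) :
    ∀ᵐ ω ∂wienerPair, Tendsto (fun m : ℕ =>
      P.rbDiscreteMart Λ N T_L T_R (t / 2 ^ m) (2 ^ m) x (pairPath ω)) atTop
      (𝓝 (P.rbEnergyMart Λ N T_L T_R t x (pairPath ω))) := by
  set cL := Real.sqrt (2 * P.γ * T_L) with hcL
  set cR := Real.sqrt (2 * P.γ * T_R) with hcR
  have hcL2 : cL ^ 2 = 2 * P.γ * T_L := Real.sq_sqrt (by positivity)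
  have hcR2 : cR ^ 2 = 2 * P.γ * T_R := Real.sq_sqrt (by positivity)
  filter_upwards [ae_tendsto_brownianQuadSum_dyadic_pair t.toNNReal] with ω hω
  obtain ⟨hω1, hω2⟩ := hω
  -- notation along the path
  set η : ℝ → ℝ × ℝ := P.rbEta N T_L T_R (pairPath ω) with hη
  set z : ℝ → RBPhaseSpace N := fun s => P.rbSolMap Λ N T_L T_R s x (pairPath ω) with hz
  have hηc : Continuous η := P.continuous_rbEta N T_L T_R _
  have hzc : Continuous z := continuous_rbSolMap hU hV hk₁ hk₂ hγ Λ N T_L T_R x (pairPath ω)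
  set Y := P.rbDrift Λ N with hY
  have hYc : Continuous Y := (P.contDiff_rbDrift hU.1 hV.1 Λ N).continuous
  -- the two scalar components: values `ρ_b`, noise `η_b`, drift `Y_b`, amplitude `(a_b, b_b)`
  -- we treat both reservoirs by one lemma applied to the projections
  have hcomp : ∀ (ρ e d : ℝ → ℝ) (a b : ℝ), Continuous e → Continuous d →
      (∀ s : ℝ, e s = a * brownian s.toNNReal ω.1 + b * brownian s.toNNReal ω.2) → a * b = 0 →
      (∀ {s : ℝ}, 0 ≤ s → ρ s - e s = (ρ 0 - e 0) + ∫ u in (0 : ℝ)..s, d u) → e 0 = 0 →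
      Tendsto (fun m : ℕ => ∑ k ∈ range (2 ^ m), ρ (k * (t / 2 ^ m)) *
          (e ((k + 1) * (t / 2 ^ m)) - e (k * (t / 2 ^ m)))) atTop
        (𝓝 (((ρ t - e t) * e t - ∫ s in (0 : ℝ)..t, e s * d s) + (e t ^ 2 - (a ^ 2 + b ^ 2) * t) / 2)) := by
    intro ρ e d a b hec hdc heab hab hA he0
    -- per `n ≥ 1`: the decomposition of the Itô sum
    have hdecomp : ∀ n : ℕ, n ≠ 0 →
        ∑ k ∈ range n, ρ (k * (t / n)) * (e ((k + 1) * (t / n)) - e (k * (t / n))) =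
          ((ρ t - e t) * e t -
            ∑ k ∈ range n, e ((k + 1) * (t / n)) * ∫ r in (k * (t / n))..((k + 1) * (t / n)), d r) +
          (e t ^ 2 - ∑ k ∈ range n, (e ((k + 1) * (t / n)) - e (k * (t / n))) ^ 2) / 2 := by
      intro n hn
      have hnr : (n : ℝ) ≠ 0 := Nat.cast_ne_zero.2 hn
      set A : ℕ → ℝ := fun k => ρ (k * (t / n)) - e (k * (t / n)) with hAdef
      set ε : ℕ → ℝ := fun k => e (k * (t / n)) with hedef
      have hterm : ∀ k : ℕ, ρ (k * (t / n)) * (e ((k + 1) * (t / n)) - e (k * (t / n))) =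
          A k * (ε (k + 1) - ε k) + ε k * (ε (k + 1) - ε k) := fun k => by
        simp only [hAdef, hedef, Nat.cast_succ]; ring
      have hn' : (n : ℝ) * (t / n) = t := mul_div_cancel₀ _ hnr
      have hAn : A n = ρ t - e t := by simp [hAdef, hn']
      have hen : ε n = e t := by simp [hedef, hn']
      have hε0 : ε 0 = 0 := by simp [hedef, he0]
      have hAdiff : ∀ k : ℕ, A (k + 1) - A k = ∫ r in (k * (t / n))..((k + 1) * (t / n)), d r := by
        intro k
        have hk0 : (0 : ℝ) ≤ k * (t / n) := by positivity
        have hk1 : (0 : ℝ) ≤ (k + 1) * (t / n) := by positivity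
        have e1 : A (k + 1) = (ρ 0 - e 0) + ∫ r in (0 : ℝ)..((k + 1) * (t / n)), d r := by
          simp only [hAdef, Nat.cast_succ]; exact hA hk1
        have e0 : A k = (ρ 0 - e 0) + ∫ r in (0 : ℝ)..(k * (t / n)), d r := hA hk0
        rw [e1, e0, add_sub_add_left_eq_sub,
          intervalIntegral.integral_interval_sub_left (hdc.intervalIntegrable _ _)
            (hdc.intervalIntegrable _ _)]
      rw [sum_congr rfl fun k _ => hterm k, sum_add_distrib, sum_mul_sub_eq_abel A ε n,
        sum_mul_sub_self_eq ε n]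
      simp_rw [hAdiff]
      rw [hAn, hen, hε0]
      simp only [hedef, Nat.cast_succ, mul_zero, sub_zero]
      ring
    -- (a) the Riemann–Stieltjes part converges
    have hRS : Tendsto (fun n : ℕ => ∑ k ∈ range n,
        e ((k + 1) * (t / n)) * ∫ r in (k * (t / n))..((k + 1) * (t / n)), d r) atTop
        (𝓝 (∫ s in (0 : ℝ)..t, e s * d s)) :=
      tendsto_sum_mul_integral_of_continuous hec hdc ht (fun n k => ((k : ℝ) + 1) * (t / n))
        fun n k _ => ⟨mul_le_mul_of_nonneg_right (by linarith) (by positivity), le_rfl⟩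
    -- (b) the quadratic sums of the noise converge (on the good event)
    have hQ : Tendsto (fun m : ℕ => ∑ k ∈ range (2 ^ m),
        (e ((k + 1) * (t / 2 ^ m)) - e (k * (t / 2 ^ m))) ^ 2) atTop (𝓝 ((a ^ 2 + b ^ 2) * t)) := by
      have hsq : ∀ m : ℕ, ∑ k ∈ range (2 ^ m), (e ((k + 1) * (t / 2 ^ m)) - e (k * (t / 2 ^ m))) ^ 2 =
          a ^ 2 * brownianQuadSum t.toNNReal (2 ^ m) ω.1 + b ^ 2 * brownianQuadSum t.toNNReal (2 ^ m) ω.2 := by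
        intro m
        unfold brownianQuadSum
        rw [mul_sum, mul_sum, ← sum_add_distrib]
        refine sum_congr rfl fun k _ => ?_
        have h1 : (((k : ℝ) + 1) * (t / 2 ^ m)).toNNReal = gridTime t.toNNReal (2 ^ m) (k + 1) := by
          have := toNNReal_mul_div_eq_gridTime ht (2 ^ m) (k + 1)
          push_cast at this ⊢
          exact this
        have h0 : ((k : ℝ) * (t / 2 ^ m)).toNNReal = gridTime t.toNNReal (2 ^ m) k := by
          have := toNNReal_mul_div_eq_gridTime ht (2 ^ m) k
          push_cast at this ⊢
          exact this
        rw [heab, heab, h1, h0]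
        have key : ∀ u v u' v' : ℝ, (a * u + b * v - (a * u' + b * v')) ^ 2 =
            a ^ 2 * (u - u') ^ 2 + b ^ 2 * (v - v') ^ 2 + 2 * (a * b) * ((u - u') * (v - v')) :=
          fun u v u' v' => by ring
        rw [key, hab]
        ring
      simp_rw [hsq]
      have hvar : (a ^ 2 + b ^ 2) * t = a ^ 2 * t + b ^ 2 * t := by ring
      rw [hvar]
      have ht' : ((t.toNNReal : ℝ≥0) : ℝ) = t := Real.coe_toNNReal t ht
      have hω1' := hω1
      have hω2' := hω2
      rw [ht'] at hω1' hω2'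
      exact (hω1'.const_mul _).add (hω2'.const_mul _)
    -- assemble along the dyadic grids
    have h2m : ∀ m : ℕ, (2 : ℕ) ^ m ≠ 0 := fun m => pow_ne_zero m two_ne_zero
    have hdec' : ∀ m : ℕ, ∑ k ∈ range (2 ^ m), ρ (k * (t / 2 ^ m)) *
        (e ((k + 1) * (t / 2 ^ m)) - e (k * (t / 2 ^ m))) =
        ((ρ t - e t) * e t -
            ∑ k ∈ range (2 ^ m), e ((k + 1) * (t / 2 ^ m)) *
              ∫ r in (k * (t / 2 ^ m))..((k + 1) * (t / 2 ^ m)), d r) +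
          (e t ^ 2 - ∑ k ∈ range (2 ^ m), (e ((k + 1) * (t / 2 ^ m)) - e (k * (t / 2 ^ m))) ^ 2) / 2 := by
      intro m
      have := hdecomp (2 ^ m) (h2m m)
      push_cast at this
      exact this
    simp_rw [hdec']
    have hpow : Tendsto (fun m : ℕ => (2 : ℕ) ^ m) atTop atTop := tendsto_pow_atTop_atTop_of_one_lt one_lt_two
    have hRS' : Tendsto (fun m : ℕ => ∑ k ∈ range (2 ^ m),
        e ((k + 1) * (t / 2 ^ m)) * ∫ r in (k * (t / 2 ^ m))..((k + 1) * (t / 2 ^ m)), d r) atTop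
        (𝓝 (∫ s in (0 : ℝ)..t, e s * d s)) := by
      have := hRS.comp hpow
      refine this.congr fun m => ?_
      simp only [Function.comp_apply]
      push_cast
      rfl
    exact (tendsto_const_nhds.sub hRS').add ((tendsto_const_nhds.sub hQ).div_const 2)
  -- apply to the two reservoirs
  obtain ⟨hA1, hA2⟩ : (∀ {s : ℝ}, 0 ≤ s → (z s).2.1 - (η s).1 = ((z 0).2.1 - (η 0).1) +
      ∫ u in (0 : ℝ)..s, (Y (z u)).2.1) ∧ (∀ {s : ℝ}, 0 ≤ s → (z s).2.2 - (η s).2 = ((z 0).2.2 - (η 0).2) +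
      ∫ u in (0 : ℝ)..s, (Y (z u)).2.2) := by
    have hz0 : z 0 = x := rbSolMap_of_nonpos hU hV hk₁ hk₂ hγ Λ N T_L T_R x _ le_rfl
    have hη0 : η 0 = 0 := P.rbEta_zero N T_L T_R _
    refine ⟨fun hs => ?_, fun hs => ?_⟩
    · rw [hz0, hη0]; simpa [hz, hη] using (rb_solMap_sub_eta_eq hU hV hk₁ hk₂ hγ Λ N T_L T_R x ω hs).1
    · rw [hz0, hη0]; simpa [hz, hη] using (rb_solMap_sub_eta_eq hU hV hk₁ hk₂ hγ Λ N T_L T_R x ω hs).2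
  have hη1 : ∀ s : ℝ, (η s).1 = cL * brownian s.toNNReal ω.1 + 0 * brownian s.toNNReal ω.2 := fun s => by
    simp [hη, P.rbEta_pairPath, hcL]
  have hη2 : ∀ s : ℝ, (η s).2 = 0 * brownian s.toNNReal ω.1 + cR * brownian s.toNNReal ω.2 := fun s => by
    simp [hη, P.rbEta_pairPath, hcR]
  have hη0 : η 0 = 0 := P.rbEta_zero N T_L T_R _
  have T1 := hcomp (fun s => (z s).2.1) (fun s => (η s).1) (fun s => (Y (z s)).2.1) cL 0
    (continuous_fst.comp hηc) (continuous_fst.comp (continuous_snd.comp (hYc.comp hzc))) hη1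
    (mul_zero _) hA1 (by rw [hη0]; rfl)
  have T2 := hcomp (fun s => (z s).2.2) (fun s => (η s).2) (fun s => (Y (z s)).2.2) 0 cR
    (continuous_snd.comp hηc) (continuous_snd.comp (continuous_snd.comp (hYc.comp hzc))) hη2
    (zero_mul _) hA2 (by rw [hη0]; rfl)
  -- the sum over the grid splits into the two reservoirs
  have hswap : ∀ m : ℕ, P.rbDiscreteMart Λ N T_L T_R (t / 2 ^ m) (2 ^ m) x (pairPath ω) =
      ∑ k ∈ range (2 ^ m), (z (k * (t / 2 ^ m))).2.1 *
          ((η ((k + 1) * (t / 2 ^ m))).1 - (η (k * (t / 2 ^ m))).1) +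
        ∑ k ∈ range (2 ^ m), (z (k * (t / 2 ^ m))).2.2 *
          ((η ((k + 1) * (t / 2 ^ m))).2 - (η (k * (t / 2 ^ m))).2) := by
    intro m
    unfold OscillatorChain.rbDiscreteMart
    rw [← sum_add_distrib]
  simp_rw [hswap]
  have hgoal : P.rbEnergyMart Λ N T_L T_R t x (pairPath ω) =
      ((((z t).2.1 - (η t).1) * (η t).1 - ∫ s in (0 : ℝ)..t, (η s).1 * (Y (z s)).2.1) +
          ((η t).1 ^ 2 - (cL ^ 2 + 0 ^ 2) * t) / 2) +
        ((((z t).2.2 - (η t).2) * (η t).2 - ∫ s in (0 : ℝ)..t, (η s).2 * (Y (z s)).2.2) +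
          ((η t).2 ^ 2 - (0 ^ 2 + cR ^ 2) * t) / 2) := by
    unfold OscillatorChain.rbEnergyMart OscillatorChain.rbNoiseWork OscillatorChain.rbNoiseVar
    simp only [hz, hη, hY, P.rbSolMap_eq_rbFlow]
    rw [← hcL2, ← hcR2]
    ring
  rw [hgoal]
  exact T1.add T2

end Limit

/-! ### The exponential supermartingale bound and its energy form -/

section ExpMart

variable {P : OscillatorChain} {k₁ k₂ : ℝ} (hU : RBGrowth P.U k₁) (hV : RBGrowth P.V k₂)
  (hk₁ : 1 ≤ k₁) (hk₂ : 1 ≤ k₂) (hγ : 0 ≤ P.γ) (Λ : ℝ) (N : ℕ) {T_L T_R : ℝ}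
  (hTL : 0 ≤ T_L) (hTR : 0 ≤ T_R)
include hU hV hk₁ hk₂ hγ

/-- `M_t` is a measurable functional of the Brownian pair. [folklore] -/
theorem rb_measurable_energyMart (t : ℝ) (x : RBPhaseSpace N) :
    Measurable fun ω => P.rbEnergyMart Λ N T_L T_R t x (pairPath ω) := by
  unfold OscillatorChain.rbEnergyMart
  refine Measurable.sub ?_ measurable_const
  exact measurable_rbNoiseWork hU hV hk₁ hk₂ hγ Λ N (X := fun _ : WienerPair => x) measurable_const
    (H := fun ω => P.rbEta N T_L T_R (pairPath ω)) (fun _ => P.continuous_rbEta N T_L T_R _)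
    (fun u => (P.measurable_rbEta N T_L T_R u).comp measurable_pairPath) t

/-- `[M]_t` is a measurable functional of the Brownian pair. [folklore] -/
theorem rb_measurable_energyQV (t : ℝ) (x : RBPhaseSpace N) :
    Measurable fun ω => P.rbEnergyQV Λ N T_L T_R t x (pairPath ω) := by
  unfold OscillatorChain.rbEnergyQV
  have hzc := fun ω => continuous_rbSolMap hU hV hk₁ hk₂ hγ Λ N T_L T_R x (pairPath ω)
  have hm := fun s => measurable_rbSolMap_pairPath_right hU hV hk₁ hk₂ hγ Λ N T_L T_R s x
  refine (Measurable.const_mul ?_ _).add (Measurable.const_mul ?_ _)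
  · refine measurable_intervalIntegral_of_continuous_of_measurable (fun ω => ?_) (fun s => ?_) t
    · exact (continuous_fst.comp (continuous_snd.comp (hzc ω))).pow 2
    · exact (measurable_fst.comp (measurable_snd.comp (hm s))).pow_const 2
  · refine measurable_intervalIntegral_of_continuous_of_measurable (fun ω => ?_) (fun s => ?_) t
    · exact (continuous_snd.comp (continuous_snd.comp (hzc ω))).pow 2
    · exact (measurable_snd.comp (measurable_snd.comp (hm s))).pow_const 2

/-- `Γ_t` is a measurable functional of the Brownian pair. [folklore] -/
theorem rb_measurable_dissipation_pairPath (t : ℝ) (x : RBPhaseSpace N) :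
    Measurable fun ω => P.rbDissipation Λ N x (P.rbEta N T_L T_R (pairPath ω)) t :=
  measurable_rbDissipation hU hV hk₁ hk₂ hγ Λ N (X := fun _ : WienerPair => x) measurable_const
    (H := fun ω => P.rbEta N T_L T_R (pairPath ω)) (fun _ => P.continuous_rbEta N T_L T_R _)
    (fun u => (P.measurable_rbEta N T_L T_R u).comp measurable_pairPath) t

include hTL hTR in
/-- **The exponential supermartingale bound** (RBT, proof of Thm 3.10: the second factor in (41)
"is the expectation of a martingale … with expectation 1"; CEHR Lemma 5.5: "a Doléans–Dade
exponential, and thus a supermartingale"): for the martingale part `M_t` of the energy and its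
quadratic variation `[M]_t`, `E_x exp(α M_t - α² [M]_t / 2) ≤ 1` for every `α`, `t ≥ 0`, `x`.
Proof: Fatou along the dyadic Riemann–Itô sums, whose exponentials have expectation exactly one.
[cite: ReyBelletThomas2002, Thm 3.10 eq. (41)] -/
theorem rb_lintegral_expMart_le_one (α : ℝ) {t : ℝ} (ht : 0 ≤ t) (x : RBPhaseSpace N) :
    ∫⁻ ω, ENNReal.ofReal (Real.exp (α * P.rbEnergyMart Λ N T_L T_R t x (pairPath ω) -
        α ^ 2 / 2 * P.rbEnergyQV Λ N T_L T_R t x (pairPath ω))) ∂wienerPair ≤ 1 := by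
  set F : ℕ → WienerPair → ℝ≥0∞ := fun m ω => ENNReal.ofReal (Real.exp
    (α * P.rbDiscreteMart Λ N T_L T_R (t / 2 ^ m) (2 ^ m) x (pairPath ω) -
      α ^ 2 / 2 * P.rbDiscreteQV Λ N T_L T_R (t / 2 ^ m) (2 ^ m) x (pairPath ω))) with hF
  have hFm : ∀ m, Measurable (F m) := fun m =>
    ENNReal.measurable_ofReal.comp (Real.measurable_exp.comp
      ((((rb_measurable_discreteMart hU hV hk₁ hk₂ hγ Λ N _ _).comp
        (measurable_const.prodMk measurable_pairPath)).const_mul _).sub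
        (((rb_measurable_discreteQV hU hV hk₁ hk₂ hγ Λ N _ _).comp
        (measurable_const.prodMk measurable_pairPath)).const_mul _)))
  have hF1 : ∀ m, ∫⁻ ω, F m ω ∂wienerPair = 1 := fun m =>
    rb_lintegral_exp_discreteMart_eq_one hU hV hk₁ hk₂ hγ Λ N hTL hTR α
      (h := t / 2 ^ m) (by positivity) (2 ^ m) x
  have hpow : Tendsto (fun m : ℕ => (2 : ℕ) ^ m) atTop atTop := tendsto_pow_atTop_atTop_of_one_lt one_lt_two
  have hlim : ∀ᵐ ω ∂wienerPair, Tendsto (fun m => F m ω) atTop (𝓝 (ENNReal.ofReal (Real.exp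
      (α * P.rbEnergyMart Λ N T_L T_R t x (pairPath ω) -
        α ^ 2 / 2 * P.rbEnergyQV Λ N T_L T_R t x (pairPath ω))))) := by
    filter_upwards [rb_ae_tendsto_discreteMart hU hV hk₁ hk₂ hγ Λ N T_L T_R hTL hTR ht x] with ω hωlim
    have hQ : Tendsto (fun m : ℕ => P.rbDiscreteQV Λ N T_L T_R (t / 2 ^ m) (2 ^ m) x (pairPath ω)) atTop
        (𝓝 (P.rbEnergyQV Λ N T_L T_R t x (pairPath ω))) := by
      have := (rb_tendsto_discreteQV hU hV hk₁ hk₂ hγ Λ N T_L T_R ht x (pairPath ω)).comp hpow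
      refine this.congr fun m => ?_
      simp only [Function.comp_apply]
      push_cast
      rfl
    exact (ENNReal.continuous_ofReal.tendsto _).comp ((Real.continuous_exp.tendsto _).comp
      ((hωlim.const_mul α).sub (hQ.const_mul _)))
  calc ∫⁻ ω, ENNReal.ofReal (Real.exp (α * P.rbEnergyMart Λ N T_L T_R t x (pairPath ω) -
          α ^ 2 / 2 * P.rbEnergyQV Λ N T_L T_R t x (pairPath ω))) ∂wienerPair
      = ∫⁻ ω, liminf (fun m => F m ω) atTop ∂wienerPair :=
        lintegral_congr_ae (hlim.mono fun ω hωlim => hωlim.liminf_eq.symm)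
    _ ≤ liminf (fun m => ∫⁻ ω, F m ω ∂wienerPair) atTop := lintegral_liminf_le hFm
    _ = 1 := by simp only [hF1, liminf_const]

include hTL hTR in
/-- **The energy form of the exponential bound** (the estimate behind RBT (41)–(42)): for every
real `θ`, with `T_max = max(T_L, T_R)` and `κ = θ(1 - θ T_max)` (positive when
`0 < θ < 1/T_max`), `E_x exp(θ G(z_t) + κ Γ_t) ≤ exp(θ G(x) + θγ(T_L + T_R) t)` — the energy
identity `G(z_t) = G(x) + M_t + γ(T_L+T_R)t - Γ_t`, the bound `[M]_t ≤ 2 T_max Γ_t`, and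
`E exp(θM_t - θ²[M]_t/2) ≤ 1`. [cite: ReyBelletThomas2002, Thm 3.10 eqs. (40)–(41)] -/
theorem rb_lintegral_exp_rbEnergy_add_dissipation_le (θ : ℝ) {t : ℝ} (ht : 0 ≤ t)
    (x : RBPhaseSpace N) :
    ∫⁻ ω, ENNReal.ofReal (Real.exp (θ * P.rbEnergy N (P.rbSolMap Λ N T_L T_R t x (pairPath ω)) +
        θ * (1 - θ * max T_L T_R) * P.rbDissipation Λ N x (P.rbEta N T_L T_R (pairPath ω)) t))
        ∂wienerPair ≤
      ENNReal.ofReal (Real.exp (θ * P.rbEnergy N x + θ * P.γ * (T_L + T_R) * t)) := by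
  -- the pointwise bound on the exponent
  have hpt : ∀ ω : WienerPair,
      θ * P.rbEnergy N (P.rbSolMap Λ N T_L T_R t x (pairPath ω)) +
        θ * (1 - θ * max T_L T_R) * P.rbDissipation Λ N x (P.rbEta N T_L T_R (pairPath ω)) t ≤
      (θ * P.rbEnergy N x + θ * P.γ * (T_L + T_R) * t) +
        (θ * P.rbEnergyMart Λ N T_L T_R t x (pairPath ω) -
          θ ^ 2 / 2 * P.rbEnergyQV Λ N T_L T_R t x (pairPath ω)) := by
    intro ω
    set η := P.rbEta N T_L T_R (pairPath ω) with hη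
    have hηc : Continuous η := P.continuous_rbEta N T_L T_R _
    -- energy identity
    have hE := rbEnergy_rbFlow_eq hU hV hk₁ hk₂ hγ Λ N x hηc ht
    rw [← P.rbSolMap_eq_rbFlow] at hE
    -- `rbNoiseWork = M + γ(T_L + T_R) t`
    have hM : P.rbNoiseWork Λ N x η t = P.rbEnergyMart Λ N T_L T_R t x (pairPath ω) + P.γ * (T_L + T_R) * t := by
      unfold OscillatorChain.rbEnergyMart
      rw [P.rbNoiseVar_add]
      simp only [hη]
      ring
    -- `[M]_t ≤ 2 T_max Γ_t`
    have hzc := continuous_rbSolMap hU hV hk₁ hk₂ hγ Λ N T_L T_R x (pairPath ω)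
    have hI1 : 0 ≤ ∫ s in (0 : ℝ)..t, (P.rbSolMap Λ N T_L T_R s x (pairPath ω)).2.1 ^ 2 :=
      intervalIntegral.integral_nonneg ht fun s _ => sq_nonneg _
    have hI2 : 0 ≤ ∫ s in (0 : ℝ)..t, (P.rbSolMap Λ N T_L T_R s x (pairPath ω)).2.2 ^ 2 :=
      intervalIntegral.integral_nonneg ht fun s _ => sq_nonneg _
    have hΓ : P.rbDissipation Λ N x η t = P.γ * ((∫ s in (0 : ℝ)..t,
        (P.rbSolMap Λ N T_L T_R s x (pairPath ω)).2.1 ^ 2) +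
        ∫ s in (0 : ℝ)..t, (P.rbSolMap Λ N T_L T_R s x (pairPath ω)).2.2 ^ 2) := by
      unfold OscillatorChain.rbDissipation
      simp only [hη, ← P.rbSolMap_eq_rbFlow]
      rw [intervalIntegral.integral_add]
      · exact ((continuous_fst.comp (continuous_snd.comp hzc)).pow 2).intervalIntegrable _ _
      · exact ((continuous_snd.comp (continuous_snd.comp hzc)).pow 2).intervalIntegrable _ _
    have hQ : P.rbEnergyQV Λ N T_L T_R t x (pairPath ω) ≤ 2 * max T_L T_R * P.rbDissipation Λ N x η t := by
      unfold OscillatorChain.rbEnergyQV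
      rw [hΓ]
      obtain ⟨hv1, hv2⟩ := P.rbNoiseVar_le hγ T_L T_R
      have hm : 0 ≤ 2 * P.γ * max T_L T_R := by
        have := (P.rbNoiseVar_nonneg hγ hTL hTR).1
        exact this.trans hv1
      nlinarith [mul_le_mul_of_nonneg_right hv1 hI1, mul_le_mul_of_nonneg_right hv2 hI2]
    have hΓ0 : 0 ≤ P.rbDissipation Λ N x η t := rbDissipation_nonneg hU hV hk₁ hk₂ hγ Λ N x hηc ht
    -- combine
    rw [hE, hM]
    have h1 : θ ^ 2 / 2 * P.rbEnergyQV Λ N T_L T_R t x (pairPath ω) ≤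
        θ ^ 2 * max T_L T_R * P.rbDissipation Λ N x η t := by
      have := mul_le_mul_of_nonneg_left hQ (by positivity : 0 ≤ θ ^ 2 / 2)
      linarith
    nlinarith [h1, hΓ0]
  -- integrate
  have hmeas : Measurable fun ω => ENNReal.ofReal (Real.exp (θ * P.rbEnergyMart Λ N T_L T_R t x (pairPath ω) -
      θ ^ 2 / 2 * P.rbEnergyQV Λ N T_L T_R t x (pairPath ω))) :=
    ENNReal.measurable_ofReal.comp (Real.measurable_exp.comp
      (((rb_measurable_energyMart hU hV hk₁ hk₂ hγ Λ N t x).const_mul _).sub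
        ((rb_measurable_energyQV hU hV hk₁ hk₂ hγ Λ N t x).const_mul _)))
  calc ∫⁻ ω, ENNReal.ofReal (Real.exp (θ * P.rbEnergy N (P.rbSolMap Λ N T_L T_R t x (pairPath ω)) +
          θ * (1 - θ * max T_L T_R) * P.rbDissipation Λ N x (P.rbEta N T_L T_R (pairPath ω)) t)) ∂wienerPair
      ≤ ∫⁻ ω, ENNReal.ofReal (Real.exp (θ * P.rbEnergy N x + θ * P.γ * (T_L + T_R) * t)) *
          ENNReal.ofReal (Real.exp (θ * P.rbEnergyMart Λ N T_L T_R t x (pairPath ω) -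
            θ ^ 2 / 2 * P.rbEnergyQV Λ N T_L T_R t x (pairPath ω))) ∂wienerPair := by
        refine lintegral_mono fun ω => ?_
        rw [← ENNReal.ofReal_mul (Real.exp_pos _).le, ← Real.exp_add]
        exact ENNReal.ofReal_le_ofReal (Real.exp_le_exp.2 (hpt ω))
    _ = ENNReal.ofReal (Real.exp (θ * P.rbEnergy N x + θ * P.γ * (T_L + T_R) * t)) *
          ∫⁻ ω, ENNReal.ofReal (Real.exp (θ * P.rbEnergyMart Λ N T_L T_R t x (pairPath ω) -
            θ ^ 2 / 2 * P.rbEnergyQV Λ N T_L T_R t x (pairPath ω))) ∂wienerPair :=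
        lintegral_const_mul _ hmeas
    _ ≤ ENNReal.ofReal (Real.exp (θ * P.rbEnergy N x + θ * P.γ * (T_L + T_R) * t)) * 1 := by
        gcongr
        exact rb_lintegral_expMart_le_one hU hV hk₁ hk₂ hγ Λ N hTL hTR θ ht x
    _ = _ := mul_one _

end ExpMart

end Literature.MathematicalPhysics.KineticTheory.HeatConduction

end
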